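import Summits.CriticalPhenomena.PercolationContinuityZ3.Theorems.PercNearOneGluingAdditiveGluingPocketMarkov
import Literature.Probability.Percolation.KozmaNitzanPreFKG
import HarnessLib

/-!
# `NoHeavyLowerTail` (stmt-CriticalPhenomena-4575) — lossy pocket cover, transfer brick: the GLUED-BLOCK TRANSFER
# with an additive slack (full-cluster form)

Support file (engine seat `prim-cplus-engine` g2; `--supports stmt-CriticalPhenomena-4575`).  No definitions, no
named facts, no sorries.  Depends only on `KozmaNitzanPreFKG.lean` (BHK event forms) and the pocket file.

* `LossyPocketT.blockSmall_le_gluedSmall_add` — for any weights, block `N ∋ v`, vertex `c`, slack `δ ≥ 0`: if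
  `μ{|π(v)| ≤ j} ≤ μ{|π(c)| ≤ j} + δ` then `μ{glued block N is j-small} ≤ μ{c is j-small in G + K_N} + δ`.
  (Kozma–Nitzan's Lemma 5 conditioned on the star pattern; their Lemma 3(ii) WITH ITS ADDITIVE SLACK is run inside
  the proof for the cluster property `|C ∩ A| ≥ j+1`.)
Used by `…LossyPocketTransferInside.lean` and `…LossyPocketCover.lean` (`bad ≤ Φ_G(c) + GAP(c)`, ENGINE-g2.md §5).
-/

noncomputable section

namespace Summit.CriticalPhenomena.PercolationContinuityZ3.Theorems

open MeasureTheory Set Literature.Probability.LatticeModels Literature.Probability.Percolation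
open Literature.Probability.Percolation.KNPreFKG
open scoped Classical BigOperators

namespace LossyPocketT

variable {n : ℕ}

/-- **Glued-block transfer, full-cluster form** (Kozma–Nitzan's Lemma 5 conditioned on the star pattern).  For any
weights, a block `N ∋ v`, a vertex `c` and a slack `δ ≥ 0`: if `μ{|π(v)| ≤ j} ≤ μ{|π(c)| ≤ j} + δ` then the
probability that the GLUED block `N` is `j`-small is at most `δ` plus the probability that `c` is `j`-small in the
graph with `N` glued (`c`'s relay set being the block's when `c ↔ N`, `π(c)` otherwise).  The proof runs
Kozma–Nitzan's Lemma 3(ii) for the monotone cluster property `|C ∩ A| ≥ j+1` WITH ITS ADDITIVE SLACK (BHK Thm 1.3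
inside `C_c`, Thm 1.5 across `C_v`/`C_c`, given `{c ↮ v}`; tree: `KNPreFKG.bhk_one_upper_lower`,
`KNPreFKG.bhk_two_upper_lower` — the argument of `Literature.….KozmaNitzan2024_lemma3_ii_cluster`, inlined) with
`Q = {c ↮ N}`, and uses `C(v) ⊆ block` on `{c ↔ N}`.
[cite: KozmaNitzan2024, Lemma 3(ii) (pp. 6–7), Lemma 5 (p. 13)] -/
theorem blockSmall_le_gluedSmall_add (w : Sym2 (Fin n) → unitInterval) (A N : Finset (Fin n))
    (c v : Fin n) (j : ℕ) (hv : v ∈ N) {δ : ℝ} (hδ : 0 ≤ δ)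
    (hyp : (prodBernoulli w).real {ω : BondConfig (Fin n) | (A.filter fun y => ω ∈ openConn v y).card ≤ j} ≤
      (prodBernoulli w).real {ω : BondConfig (Fin n) | (A.filter fun y => ω ∈ openConn c y).card ≤ j} + δ) :
    (prodBernoulli w).real {ω : BondConfig (Fin n) |
        (A.filter fun y => ∃ a ∈ N, ω ∈ openConn a y).card ≤ j} ≤
      (prodBernoulli w).real {ω : BondConfig (Fin n) |
        ((∃ a ∈ N, ω ∈ openConn c a) ∧ (A.filter fun y => ∃ a ∈ N, ω ∈ openConn a y).card ≤ j) ∨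
          ((¬ ∃ a ∈ N, ω ∈ openConn c a) ∧ (A.filter fun y => ω ∈ openConn c y).card ≤ j)} + δ := by
  classical
  set μ := prodBernoulli w with hμ
  -- the monotone cluster property `|C ∩ A| ≥ j+1` and its edge-cluster reading
  set P : Set (Fin n) → Prop := fun S => j + 1 ≤ (A.filter fun x => x ∈ S).card with hP
  have hPmono : ∀ S T : Set (Fin n), S ⊆ T → P S → P T := by
    intro S T hST hS
    refine le_trans hS (Finset.card_le_card fun x hx => ?_)
    simp only [Finset.mem_filter] at hx ⊢
    exact ⟨hx.1, hST hx.2⟩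
  have card_openCluster : ∀ (ω : BondConfig (Fin n)) (a : Fin n),
      (A.filter fun x => x ∈ openCluster ω a).card = (A.filter fun x => ω ∈ openConn a x).card := by
    intro ω a
    have h : (A.filter fun x => x ∈ openCluster ω a) = (A.filter fun x => ω ∈ openConn a x) :=
      Finset.filter_congr fun x _ => Iff.rfl
    rw [h]
  have openCluster_eq_setOf_openEdgeCluster' : ∀ (ω : BondConfig (Fin n)) (s : Fin n),
      openCluster ω s = {a | a = s ∨ ∃ e ∈ openEdgeCluster ω s, a ∈ e} := by
    intro ω s; ext a; exact reachable_iff_exists_mem_openEdgeCluster ω s a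
  have isUpperSet_clusterPropFamily' : ∀ s : Fin n,
      IsUpperSet {C : Set (Sym2 (Fin n)) | P {a | a = s ∨ ∃ e ∈ C, a ∈ e}} := by
    intro s C C' hCC' hC
    refine hPmono _ _ (fun a ha => ?_) hC
    rcases ha with h | ⟨e, he, hae⟩
    · exact Or.inl h
    · exact Or.inr ⟨e, hCC' he, hae⟩
  have setOf_prop_openCluster_eq' : ∀ s : Fin n, {ω : BondConfig (Fin n) | P (openCluster ω s)} =
      {ω | openEdgeCluster ω s ∈ {C : Set (Sym2 (Fin n)) | P {a | a = s ∨ ∃ e ∈ C, a ∈ e}}} := by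
    intro s; ext ω; simp only [mem_setOf_eq, openCluster_eq_setOf_openEdgeCluster']
  have openCluster_eq_of_reachable' : ∀ {ω : BondConfig (Fin n)} {x y : Fin n},
      (openGraph ω).Reachable x y → openCluster ω x = openCluster ω y := by
    intro ω x y h; ext a; exact ⟨fun ha => h.symm.trans ha, fun ha => h.trans ha⟩
  -- Kozma–Nitzan's Lemma 3(ii) with slack for `P` (argument of `KozmaNitzan2024_lemma3_ii_cluster`)
  have L3 : ∀ (a₁ a₂ : Fin n), (μ.real {ω | P (openCluster ω a₁)} ≤ μ.real {ω | P (openCluster ω a₂)} + δ) →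
      ∀ {𝒬 : Set (Set (Sym2 (Fin n)))}, IsLowerSet 𝒬 →
      μ.real ({ω | P (openCluster ω a₁)} ∩ {ω | openEdgeCluster ω a₁ ∈ 𝒬}) ≤
        μ.real ({ω | P (openCluster ω a₂)} ∩ {ω | openEdgeCluster ω a₁ ∈ 𝒬}) + δ := by
    intro a₁ a₂ h 𝒬 h𝒬
    set X₁ : Set (BondConfig (Fin n)) := {ω | P (openCluster ω a₁)} with hX₁
    set X₂ : Set (BondConfig (Fin n)) := {ω | P (openCluster ω a₂)} with hX₂
    set Q : Set (BondConfig (Fin n)) := {ω | openEdgeCluster ω a₁ ∈ 𝒬} with hQ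
    by_cases h12 : a₁ = a₂
    · subst h12
      linarith [h]
    set D : Set (BondConfig (Fin n)) := {ω | ¬ (openGraph ω).Reachable a₁ a₂} with hD
    -- on `Dᶜ` the two events agree (same cluster)
    have hagree : X₁ ∩ Dᶜ = X₂ ∩ Dᶜ := by
      ext ω
      simp only [mem_inter_iff, mem_compl_iff, mem_setOf_eq, not_not, hX₁, hX₂, hD]
      constructor
      · rintro ⟨h1, h2⟩
        exact ⟨by rwa [← openCluster_eq_of_reachable' h2], h2⟩
      · rintro ⟨h1, h2⟩
        exact ⟨by rwa [openCluster_eq_of_reachable' h2], h2⟩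
    -- split every event along `D`
    have hsplit : ∀ A : Set (BondConfig (Fin n)), μ.real A = μ.real (A ∩ D) + μ.real (A ∩ Dᶜ) := by
      intro A
      rw [← measureReal_inter_add_sdiff (s := A) (MeasurableSet.of_discrete : MeasurableSet D),
        Set.sdiff_eq]
    -- the hypothesis restricted to `D`
    have hH : μ.real (D ∩ X₁) ≤ μ.real (D ∩ X₂) + δ := by
      have h' := h
      rw [hsplit X₁, hsplit X₂, hagree] at h'
      rw [inter_comm D X₁, inter_comm D X₂]
      linarith
    -- the events in edge-cluster form
    have hX₁e : X₁ = {ω | openEdgeCluster ω a₁ ∈ {C : Set (Sym2 (Fin n)) | P {a | a = a₁ ∨ ∃ e ∈ C, a ∈ e}}} :=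
      setOf_prop_openCluster_eq' a₁
    have hX₂e : X₂ = {ω | openEdgeCluster ω a₂ ∈ {C : Set (Sym2 (Fin n)) | P {a | a = a₂ ∨ ∃ e ∈ C, a ∈ e}}} :=
      setOf_prop_openCluster_eq' a₂
    -- (1) one-cluster BHK: `s = a₁`, `X = {a₂}`, increasing `X₁`, decreasing `Q`
    have hD1 : {ω : BondConfig (Fin n) | ∀ x ∈ ({a₂} : Set (Fin n)), ¬ (openGraph ω).Reachable a₁ x} = D := by
      ext ω
      simp [hD]
    have h1 := bhk_one_upper_lower w a₁ ({a₂} : Set (Fin n)) (by simpa using h12)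
      (isUpperSet_clusterPropFamily' a₁) h𝒬
    rw [hD1, ← hX₁e] at h1
    -- (3) two-cluster BHK: `s = a₂`, `t = a₁`, increasing `X₂` in `C_{a₂}`, decreasing `Q` in `C_{a₁}`
    have hD2 : {ω : BondConfig (Fin n) | ¬ (openGraph ω).Reachable a₂ a₁} = D := by
      ext ω
      simp only [mem_setOf_eq, hD]
      exact not_congr ⟨SimpleGraph.Reachable.symm, SimpleGraph.Reachable.symm⟩
    have h3 := bhk_two_upper_lower w a₂ a₁ (Ne.symm h12) (isUpperSet_clusterPropFamily' a₂) h𝒬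
    rw [hD2, ← hX₂e] at h3
    have hQD : μ.real (D ∩ Q) ≤ μ.real D := measureReal_mono inter_subset_left
    -- the inequality on `D`
    have hcore : μ.real (X₁ ∩ Q ∩ D) ≤ μ.real (X₂ ∩ Q ∩ D) + δ := by
      rw [inter_comm (X₁ ∩ Q) D, inter_comm (X₂ ∩ Q) D]
      by_cases hD0 : μ.real D = 0
      · have h0 : μ.real (D ∩ (X₁ ∩ Q)) = 0 :=
          le_antisymm ((measureReal_mono inter_subset_left).trans hD0.le) measureReal_nonneg
        rw [h0]
        exact add_nonneg measureReal_nonneg hδ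
      · have hDpos : 0 < μ.real D := lt_of_le_of_ne measureReal_nonneg (Ne.symm hD0)
        have hchain : μ.real D * μ.real (D ∩ (X₁ ∩ Q)) ≤
            μ.real D * (μ.real (D ∩ (X₂ ∩ Q)) + δ) := by
          calc μ.real D * μ.real (D ∩ (X₁ ∩ Q))
              ≤ μ.real (D ∩ X₁) * μ.real (D ∩ Q) := h1
            _ ≤ (μ.real (D ∩ X₂) + δ) * μ.real (D ∩ Q) :=
                mul_le_mul_of_nonneg_right hH measureReal_nonneg
            _ = μ.real (D ∩ X₂) * μ.real (D ∩ Q) + δ * μ.real (D ∩ Q) := by ring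
            _ ≤ μ.real D * μ.real (D ∩ (X₂ ∩ Q)) + δ * μ.real D :=
                add_le_add h3 (mul_le_mul_of_nonneg_left hQD hδ)
            _ = μ.real D * (μ.real (D ∩ (X₂ ∩ Q)) + δ) := by ring
        exact le_of_mul_le_mul_left hchain hDpos
    -- conclude by adding the parts on `Dᶜ`, where the events coincide
    have hagreeQ : X₁ ∩ Q ∩ Dᶜ = X₂ ∩ Q ∩ Dᶜ := by
      rw [inter_right_comm, hagree, inter_right_comm]
    calc μ.real (X₁ ∩ Q) = μ.real (X₁ ∩ Q ∩ D) + μ.real (X₁ ∩ Q ∩ Dᶜ) := hsplit _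
      _ ≤ μ.real (X₂ ∩ Q ∩ D) + δ + μ.real (X₂ ∩ Q ∩ Dᶜ) := by
          rw [hagreeQ]
          linarith [hcore]
      _ = μ.real (X₂ ∩ Q) + δ := by
          rw [hsplit (X₂ ∩ Q)]
          ring
  -- events
  set Sv : Set (BondConfig (Fin n)) := {ω | (A.filter fun y => ω ∈ openConn v y).card ≤ j} with hSv
  set Sc : Set (BondConfig (Fin n)) := {ω | (A.filter fun y => ω ∈ openConn c y).card ≤ j} with hSc
  set Sb : Set (BondConfig (Fin n)) := {ω | (A.filter fun y => ∃ a ∈ N, ω ∈ openConn a y).card ≤ j} with hSb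
  set T : Set (BondConfig (Fin n)) := {ω | ∃ a ∈ N, ω ∈ openConn c a} with hT
  set Sg : Set (BondConfig (Fin n)) := {ω |
      ((∃ a ∈ N, ω ∈ openConn c a) ∧ (A.filter fun y => ∃ a ∈ N, ω ∈ openConn a y).card ≤ j) ∨
        ((¬ ∃ a ∈ N, ω ∈ openConn c a) ∧ (A.filter fun y => ω ∈ openConn c y).card ≤ j)} with hSg
  have hXc : {ω : BondConfig (Fin n) | P (openCluster ω c)} = Scᶜ := by
    ext ω; simp only [hP, hSc, mem_setOf_eq, mem_compl_iff, not_le, card_openCluster]; omega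
  have hXv : {ω : BondConfig (Fin n) | P (openCluster ω v)} = Svᶜ := by
    ext ω; simp only [hP, hSv, mem_setOf_eq, mem_compl_iff, not_le, card_openCluster]; omega
  -- the hypothesis in the `P`-form
  have h' : μ.real {ω : BondConfig (Fin n) | P (openCluster ω c)} ≤
      μ.real {ω : BondConfig (Fin n) | P (openCluster ω v)} + δ := by
    rw [hXc, hXv, probReal_compl_eq_one_sub MeasurableSet.of_discrete,
      probReal_compl_eq_one_sub MeasurableSet.of_discrete]
    linarith
  -- Lemma 3(ii) with slack, `Q = {c ↮ N}`
  have L3' : μ.real (Scᶜ ∩ {ω | ∀ u ∈ (↑N : Set (Fin n)), ¬ (openGraph ω).Reachable c u}) ≤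
      μ.real (Svᶜ ∩ {ω | ∀ u ∈ (↑N : Set (Fin n)), ¬ (openGraph ω).Reachable c u}) + δ := by
    have key := L3 c v h' (isLowerSet_disconnFamily c (↑N))
    rw [← setOf_forall_not_reachable_eq, hXc, hXv] at key
    exact key
  -- `{c ↮ N} = Tᶜ`
  have hTc : {ω : BondConfig (Fin n) | ∀ u ∈ (↑N : Set (Fin n)), ¬ (openGraph ω).Reachable c u} = Tᶜ := by
    ext ω
    simp only [hT, mem_setOf_eq, mem_compl_iff, not_exists, not_and, Finset.mem_coe]
    rfl
  rw [hTc] at L3'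
  -- `C(v) big ⇒ block big`
  have hvb : Svᶜ ⊆ Sbᶜ := by
    intro ω hω
    simp only [hSv, hSb, mem_compl_iff, mem_setOf_eq, not_le] at hω ⊢
    refine lt_of_lt_of_le hω (Finset.card_le_card fun y hy => ?_)
    simp only [Finset.mem_filter] at hy ⊢
    exact ⟨hy.1, v, hv, hy.2⟩
  -- `Sgᶜ ⊆ (T ∩ Sbᶜ) ∪ (Tᶜ ∩ Scᶜ)`
  have hSg : Sgᶜ ⊆ (T ∩ Sbᶜ) ∪ (Scᶜ ∩ Tᶜ) := by
    intro ω hω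
    simp only [hSg, hT, hSb, hSc, mem_compl_iff, mem_setOf_eq, mem_union, mem_inter_iff, not_or, not_and,
      not_le] at hω ⊢
    by_cases hcT : ∃ a ∈ N, ω ∈ openConn c a
    · exact Or.inl ⟨hcT, hω.1 hcT⟩
    · exact Or.inr ⟨hω.2 hcT, hcT⟩
  have e1 : μ.real (Sbᶜ ∩ T) + μ.real (Sbᶜ \ T) = μ.real Sbᶜ :=
    measureReal_inter_add_sdiff (MeasurableSet.of_discrete : MeasurableSet T) (measure_ne_top _ _)
  have hglue : μ.real Sgᶜ ≤ μ.real Sbᶜ + δ :=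
    calc μ.real Sgᶜ ≤ μ.real ((T ∩ Sbᶜ) ∪ (Scᶜ ∩ Tᶜ)) := measureReal_mono hSg
      _ ≤ μ.real (T ∩ Sbᶜ) + μ.real (Scᶜ ∩ Tᶜ) := measureReal_union_le _ _
      _ ≤ μ.real (T ∩ Sbᶜ) + (μ.real (Svᶜ ∩ Tᶜ) + δ) := by linarith [L3']
      _ ≤ μ.real (Sbᶜ ∩ T) + μ.real (Sbᶜ \ T) + δ := by
          rw [inter_comm T Sbᶜ, Set.sdiff_eq]
          linarith [measureReal_mono (μ := μ) (show Svᶜ ∩ Tᶜ ⊆ Sbᶜ ∩ Tᶜ from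
            fun ω ⟨h1, h2⟩ => ⟨hvb h1, h2⟩)]
      _ = μ.real Sbᶜ + δ := by rw [e1]
  rw [probReal_compl_eq_one_sub MeasurableSet.of_discrete,
    probReal_compl_eq_one_sub MeasurableSet.of_discrete] at hglue
  linarith

end LossyPocketT

end Summit.CriticalPhenomena.PercolationContinuityZ3.Theorems

end
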